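import Literature.NumberTheory.EllipticCurves.Kato2004.IwasawaCohomologyZetaLift
import Literature.NumberTheory.EllipticCurves.CyclotomicZpExtensionLayerTwoProofs
import HarnessLib

/-!
# Kato 2004 §13.1 / Thm. 13.4 at `p = 2`: the Λ-adic ZETA CLASS is PINNED in `𝐇¹_Γ(T₂W)` — the `2`-power
# levels `z_{n+2,∅} ∈ H¹(ℚ(μ_{2^{n+2}}), T₂W)` of an Euler system corestrict to the layers `ℚ_n = ℚ(ζ_{2^{n+2}})⁺`
# of the cyclotomic `ℤ₂`-tower and lift to ONE element of `Kato2004.IwasawaH1Data` (the `p = 2` twin of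
# `IwasawaCohomologyEulerSystemLift` / `…EulerSystemLiftComp` / `IwasawaCohomologyZetaLift`, which keep `p` odd)

Topic `NumberTheory/EllipticCurves`, sub-directory `Kato2004` (namespace = path).  Cell `bsd-2adic`, prover seat
`bsd-2adic-conv-2` (GEN 10), items stmt-BirchSwinnertonDyer-19219 / -19218 (rank-`0` `2`-converse cruxes of route
`TwoAdicConverse`).  WHY: the three odd-`p` files corestrict the level `Gal(ℚ̄/ℚ(μ_{p^{n+1}}))` to the layer
`Gal(ℚ̄/ℚ_n)`; at `p = 2` the layer `ℚ_n` (degree `2^n`) lies in `ℚ(μ_{2^{n+2}})`, NOT in `ℚ(μ_{2^{n+1}})`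
(`μ(ℤ₂) = {±1}`; `ℚ_1 = ℚ(√2) ⊂ ℚ(μ₈)`), and the layer inclusion with this shift is the tree theorem
`ZpExtension.IsCyclotomic.cyclotomicLevelsRat_level_le_layerSubgroup_two` (file
`CyclotomicZpExtensionLayerTwoProofs`, seat bsd-2adic-ord-2) — the `TODO(general form)` recorded in
`IwasawaCohomologyZetaLift` / `IwasawaH2Descent` («the layer inclusion … for `p = 2` so that `levelToLayer` and
the zeta lift exist at `p = 2`»).  This file is that twin: the SAME proofs with the level index `n + 1 ↦ n + 2`.
Consumers: every `p = 2` road that displayed «Kato's zeta element `𝐳 ∈ 𝐇¹_Γ(T₂E)`» abstractly — cell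
bsd-2adic's Kato–zeta road to the rank-`0` `2`-converse (`Theorems/TwoAdicConverseKatoZetaPinned.lean`, whose
research binder (VAN-K) becomes Kato's explicit-reciprocity READING once `z` is the pinned lift), cell
bsd-cn100's line `kato-zeta-perrin-riou` at `(E_n, 2)`, cell bsd-2adic's K11 road (`MultDivisibilityInputs.Z`).

## What is here (all at `p = 2`; `κ` any cyclotomic `ℤ₂`-extension datum)

* `levelToLayerTwo W hκ S n` — `Cor : H¹(ℚ(μ_{2^{n+2}}), T₂W) → H¹(ℚ_n, T₂W)`, the tree's `coresLe` along
  `Gal(ℚ̄/ℚ(μ_{2^{n+2}})) ≤ Gal(ℚ̄/ℚ_n)`; a plumbing `def`.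
* `IwasawaH1Data.existsUnique_lift_of_isEulerSystem_two` — for an Euler system `z` on the levels of
  `cyclotomicLevelsRat 2 S`, the family `y_n := Cor(z_{n+2,∅})` lifts to a UNIQUE `𝐲 ∈ 𝐇¹_Γ(T₂W)` with
  `proj n 𝐲 = y_n`, GIVEN the two corestriction hypotheses `hcomp` (transitivity) and `hint` (integrality).
* `levelToLayerTwo_layerCores_comm` — `hcomp` PROVED (`coresLe_comp`): `Cor_{ℚ_{n+1}/ℚ_n} ∘ Cor_{ℚ(μ_{2^{n+3}})/ℚ_{n+1}}
  = Cor_{ℚ(μ_{2^{n+2}})/ℚ_n} ∘ Cor_{ℚ(μ_{2^{n+3}})/ℚ(μ_{2^{n+2}})}`.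
* `IwasawaH1Data.existsUnique_lift_of_isEulerSystem_of_integral_two` — only `hint` displayed.
* `IwasawaH1Data.existsUnique_lift_of_zetaBody_two` — for a `ZetaBody W 2 f ι κ' Λ' c d a A z x` witness (Kato's
  Euler system for `T₂W` with its values; the named facts `exists_eulerSystem_expStar_values` /
  `exists_member_eulerSystem_expStar_values` carry NO parity hypothesis for existence + norm relations), a UNIQUE
  `𝐲 ∈ 𝐇¹_Γ(T₂W)` with `proj n 𝐲 = Cor_{ℚ(μ_{2^{n+2}})/ℚ_n}(z_{n+2,∅})`: integrality from (C2) +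
  `coresLe_mem_integralH1` (`ℚ(μ_{2^{n+2}})/ℚ` normal, unramified away from `2`).
HONEST FRAMING: THEOREMS + one plumbing `def`; no named fact minted; nothing asserted beyond the displayed
hypotheses / the `ZetaBody` witness; no statement about the VALUES of `𝐲` (they are (C4)–(C5) of the witness at
the finite levels; at `p = 2` Kato's `p`-adic zeta function needs a root `α` as in §16.1 — automatic for
multiplicative or good ordinary `2`, absent e.g. for `E_n`); BSD is not advanced.  No `instance`, no notation.

References: K. Kato, Astérisque 295 (2004) §8.2 (pp. 180–181), §12.2 (p. 220), §13.1 and Thm. 13.4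
(pp. 224–226) [Kato2004Asterisque]; L. C. Washington, *Introduction to Cyclotomic Fields* §13.1 (`ℚ_n ⊂ ℚ(ζ_{2^{n+2}})`)
[Washington1997]; J. Neukirch, A. Schmidt, K. Wingberg, *Cohomology of Number Fields*, Prop. 1.5.3 [NSW2008];
tree: `Kato2004/IwasawaCohomologyEulerSystemLift{,Comp}.lean`, `Kato2004/IwasawaCohomologyZetaLift.lean` (odd `p`),
`CyclotomicZpExtensionLayerTwoProofs.lean`, `GaloisRepresentations/ContinuousCorestriction{,Comp}.lean`
(`coresLe`, `coresLe_comp`), `Kato2004/IntegralH1Corestriction.lean` (`coresLe_mem_integralH1`).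
-/

noncomputable section

open scoped NumberField TensorProduct
open Field IsDedekindDomain
open Literature.NumberTheory.GaloisRepresentations
open Literature.NumberTheory.EllipticCurves Literature.NumberTheory.EllipticCurves.Kato2004
open Literature.NumberTheory.EllipticCurves.Kato2004.EulerSystemValues Rat.HeightOneSpectrum

namespace Literature.NumberTheory.EllipticCurves.Kato2004

variable (W : WeierstrassCurve ℚ) [W.IsElliptic] [ContinuousSMul ℤ_[2] (W.tateModule 2)]
  {κ : ZpExtension ℚ 2} (hκ : κ.IsCyclotomic)

/-! ## §1 `Cor : H¹(ℚ(μ_{2^{n+2}}), T₂W) → H¹(ℚ_n, T₂W)` and the lift over two displayed hypotheses -/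

/-- **`Cor : H¹(ℚ(μ_{2^{n+2}}), T₂W) → H¹(ℚ_n, T₂W)`** — the corestriction from the Euler-system level
`(cyclotomicLevelsRat 2 S).level (n+2) ∅ = Gal(ℚ̄/ℚ(μ_{2^{n+2}}))` to the `n`-th layer of the cyclotomic `ℤ₂`-tower
`κ` (`ℚ_n = ℚ(ζ_{2^{n+2}})⁺ ⊂ ℚ(μ_{2^{n+2}})`, Washington §13.1), i.e. the tree's `coresLe` along
`ZpExtension.IsCyclotomic.cyclotomicLevelsRat_level_le_layerSubgroup_two`. The `p = 2` twin of `levelToLayer`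
(level index `n + 2` instead of `n + 1`). Plumbing definition. [cite: Washington1997, §13.1] -/
def levelToLayerTwo (S : Set (HeightOneSpectrum (𝓞 ℚ))) (n : ℕ) :
    H1 (tateRep W 2) ((cyclotomicLevelsRat 2 S).level (n + 2) ∅) →ₗ[ℤ_[2]]
      H1 (tateRep W 2) (κ.layerSubgroup n) :=
  haveI : ((cyclotomicLevelsRat 2 S).level (n + 2) ∅).FiniteIndex :=
    finiteIndex_of_isOpen_of_compactSpace _ ((cyclotomicLevelsRat 2 S).isOpen_level (n + 2) ∅)
  haveI : Fintype (κ.layerSubgroup n ⧸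
      ((cyclotomicLevelsRat 2 S).level (n + 2) ∅).subgroupOf (κ.layerSubgroup n)) :=
    Fintype.ofFinite _
  coresLe (tateRep W 2).toTopRep (hκ.cyclotomicLevelsRat_level_le_layerSubgroup_two S n)
    ((cyclotomicLevelsRat 2 S).isOpen_level (n + 2) ∅)

variable {γ : absoluteGaloisGroup ℚ} (I : IwasawaH1Data W 2 κ γ)

/-- **The Λ-adic class of the `2`-power levels of an Euler system (Kato §13.1 / Thm. 13.4, "`Z` … generated by
`(z_{p^n})_n`", at `p = 2`), assembled over two displayed hypotheses.**  Let `z` be an Euler system for `T₂W` on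
the levels of `cyclotomicLevelsRat 2 S` and put `y_n := Cor_{ℚ(μ_{2^{n+2}})/ℚ_n}(z_{n+2,∅}) ∈ H¹(ℚ_n, T₂W)`.
GRANTED (displayed, not proved here) the transitivity of corestriction on the relevant triples (`hcomp`) and the
integrality of the corestricted classes (`hint`), the family `(y_n)_n` is norm-compatible and integral, hence there
is a UNIQUE `𝐲 ∈ 𝐇¹_Γ(T₂W)` (the pinned `IwasawaH1Data`) with `proj n 𝐲 = y_n` for every `n`. The `p = 2` twin of
`IwasawaH1Data.existsUnique_lift_of_isEulerSystem`. [cite: Kato2004Asterisque, §13.1 and Thm. 13.4 (pp. 224–226), §12.2 (p. 220)] -/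
theorem IwasawaH1Data.existsUnique_lift_of_isEulerSystem_two
    [Module.Free ℤ_[2] (W.tateModule 2)] [Module.Finite ℤ_[2] (W.tateModule 2)]
    (S : Set (HeightOneSpectrum (𝓞 ℚ)))
    (z : ∀ (k : ℕ) (r : (cyclotomicLevelsRat 2 S).Ideals),
      H1 (tateRep W 2) ((cyclotomicLevelsRat 2 S).level k r.1))
    (hz : IsEulerSystem (cyclotomicLevelsRat 2 S) (tateRep W 2) 2 z)
    (hcomp : ∀ (n : ℕ) (x : H1 (tateRep W 2) ((cyclotomicLevelsRat 2 S).level (n + 3) ∅)),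
      layerCores (tateRep W 2) κ n (levelToLayerTwo W hκ S (n + 1) x) =
        levelToLayerTwo W hκ S n
          ((cyclotomicLevelsRat 2 S).coresP (tateRep W 2) (Nat.le_succ (n + 2)) ∅ x))
    (hint : ∀ n : ℕ, levelToLayerTwo W hκ S n (z (n + 2) (cyclotomicLevelsRat 2 S).idealOne) ∈
      integralH1 (tateRep W 2) 2 (κ.layerSubgroup n)) :
    ∃! y : I.H, ∀ n : ℕ,
      I.proj n y = levelToLayerTwo W hκ S n (z (n + 2) (cyclotomicLevelsRat 2 S).idealOne) := by
  refine I.exists_unique_lift ⟨hint, fun n ↦ ?_⟩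
  -- norm compatibility along the tower: transitivity of `Cor` + the `p`-direction Euler-system relation
  rw [hcomp n]
  congr 1
  exact hz.cores_p (Nat.le_succ (n + 2)) (cyclotomicLevelsRat 2 S).idealOne

/-! ## §2 Transitivity of corestriction: `hcomp` PROVED -/

/-- **The two corestriction routes from `ℚ(μ_{2^{n+3}})` to `ℚ_n` agree**:
`Cor_{ℚ_{n+1}/ℚ_n} ∘ Cor_{ℚ(μ_{2^{n+3}})/ℚ_{n+1}} = Cor_{ℚ(μ_{2^{n+2}})/ℚ_n} ∘ Cor_{ℚ(μ_{2^{n+3}})/ℚ(μ_{2^{n+2}})}`, both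
being `Cor_{ℚ(μ_{2^{n+3}})/ℚ_n}` by transitivity of corestriction (`coresLe_comp`). This is hypothesis `hcomp` of
`IwasawaH1Data.existsUnique_lift_of_isEulerSystem_two`; the `p = 2` twin of `levelToLayer_layerCores_comm`.
[cite: NeukirchSchmidtWingberg2008, I §5 (1.5.3)–(1.5.6)] -/
theorem levelToLayerTwo_layerCores_comm (S : Set (HeightOneSpectrum (𝓞 ℚ))) (n : ℕ)
    (x : H1 (tateRep W 2) ((cyclotomicLevelsRat 2 S).level (n + 3) ∅)) :
    layerCores (tateRep W 2) κ n (levelToLayerTwo W hκ S (n + 1) x) =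
      levelToLayerTwo W hκ S n
        ((cyclotomicLevelsRat 2 S).coresP (tateRep W 2) (Nat.le_succ (n + 2)) ∅ x) := by
  -- the finite-index instances for the composite `Gal(ℚ̄/ℚ(μ_{2^{n+3}})) ≤ Gal(ℚ̄/ℚ_n)`
  haveI : ((cyclotomicLevelsRat 2 S).level (n + 3) ∅).FiniteIndex :=
    finiteIndex_of_isOpen_of_compactSpace _ ((cyclotomicLevelsRat 2 S).isOpen_level (n + 3) ∅)
  haveI : ((cyclotomicLevelsRat 2 S).level (n + 2) ∅).FiniteIndex :=
    finiteIndex_of_isOpen_of_compactSpace _ ((cyclotomicLevelsRat 2 S).isOpen_level (n + 2) ∅)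
  haveI : (κ.layerSubgroup (n + 1)).FiniteIndex :=
    finiteIndex_of_isOpen_of_compactSpace _ (κ.isOpen_layerSubgroup (n + 1))
  haveI : Fintype (κ.layerSubgroup n ⧸
      ((cyclotomicLevelsRat 2 S).level (n + 3) ∅).subgroupOf (κ.layerSubgroup n)) := Fintype.ofFinite _
  haveI : Fintype (κ.layerSubgroup (n + 1) ⧸
      ((cyclotomicLevelsRat 2 S).level (n + 3) ∅).subgroupOf (κ.layerSubgroup (n + 1))) :=
    Fintype.ofFinite _
  haveI : Fintype (κ.layerSubgroup n ⧸ (κ.layerSubgroup (n + 1)).subgroupOf (κ.layerSubgroup n)) :=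
    Fintype.ofFinite _
  haveI : Fintype (κ.layerSubgroup n ⧸
      ((cyclotomicLevelsRat 2 S).level (n + 2) ∅).subgroupOf (κ.layerSubgroup n)) := Fintype.ofFinite _
  haveI : Fintype ((cyclotomicLevelsRat 2 S).level (n + 2) ∅ ⧸
      ((cyclotomicLevelsRat 2 S).level (n + 3) ∅).subgroupOf ((cyclotomicLevelsRat 2 S).level (n + 2) ∅)) :=
    Fintype.ofFinite _
  have h₁ : (cyclotomicLevelsRat 2 S).level (n + 3) ∅ ≤ κ.layerSubgroup (n + 1) :=
    hκ.cyclotomicLevelsRat_level_le_layerSubgroup_two S (n + 1)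
  have h₁' : κ.layerSubgroup (n + 1) ≤ κ.layerSubgroup n := κ.layerSubgroup_antitone (Nat.le_succ n)
  have h₂ : (cyclotomicLevelsRat 2 S).level (n + 3) ∅ ≤ (cyclotomicLevelsRat 2 S).level (n + 2) ∅ :=
    (cyclotomicLevelsRat 2 S).level_mono_left (Nat.le_succ (n + 2)) ∅
  have h₂' : (cyclotomicLevelsRat 2 S).level (n + 2) ∅ ≤ κ.layerSubgroup n :=
    hκ.cyclotomicLevelsRat_level_le_layerSubgroup_two S n
  have hV := (cyclotomicLevelsRat 2 S).isOpen_level (n + 3) ∅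
  -- route 1: level (n+3) → layer (n+1) → layer n;  route 2: level (n+3) → level (n+2) → layer n
  have r₁ := LinearMap.congr_fun
    (coresLe_comp (tateRep W 2).toTopRep h₁ h₁' hV (κ.isOpen_layerSubgroup (n + 1))) x
  have r₂ := LinearMap.congr_fun
    (coresLe_comp (tateRep W 2).toTopRep h₂ h₂' hV ((cyclotomicLevelsRat 2 S).isOpen_level (n + 2) ∅)) x
  rw [LinearMap.comp_apply] at r₁ r₂
  unfold layerCores levelToLayerTwo EulerSystemLevels.coresP
  -- the two sides are the two routes; `Fintype` instances are subsingletons (closed by `convert`)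
  convert r₁.trans r₂.symm using 5

/-- **The Λ-adic class of the `2`-power levels of an Euler system, with only INTEGRALITY displayed.**  For an
Euler system `z` for `T₂W` on the levels of `cyclotomicLevelsRat 2 S` (`κ` cyclotomic), GRANTED that the
corestricted classes `Cor_{ℚ(μ_{2^{n+2}})/ℚ_n}(z_{n+2,∅})` are integral (`hint`), there is a UNIQUE `𝐲 ∈ 𝐇¹_Γ(T₂W)`
with `proj n 𝐲 = Cor(z_{n+2,∅})` for all `n`; the norm-compatibility is a THEOREM
(`levelToLayerTwo_layerCores_comm` + `IsEulerSystem.cores_p`). The `p = 2` twin of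
`IwasawaH1Data.existsUnique_lift_of_isEulerSystem_of_integral`.
[cite: Kato2004Asterisque, §13.1 and Thm. 13.4 (pp. 224–226), §12.2 (p. 220)] -/
theorem IwasawaH1Data.existsUnique_lift_of_isEulerSystem_of_integral_two
    [Module.Free ℤ_[2] (W.tateModule 2)] [Module.Finite ℤ_[2] (W.tateModule 2)]
    (S : Set (HeightOneSpectrum (𝓞 ℚ)))
    (z : ∀ (k : ℕ) (r : (cyclotomicLevelsRat 2 S).Ideals),
      H1 (tateRep W 2) ((cyclotomicLevelsRat 2 S).level k r.1))
    (hz : IsEulerSystem (cyclotomicLevelsRat 2 S) (tateRep W 2) 2 z)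
    (hint : ∀ n : ℕ, levelToLayerTwo W hκ S n (z (n + 2) (cyclotomicLevelsRat 2 S).idealOne) ∈
      integralH1 (tateRep W 2) 2 (κ.layerSubgroup n)) :
    ∃! y : I.H, ∀ n : ℕ,
      I.proj n y = levelToLayerTwo W hκ S n (z (n + 2) (cyclotomicLevelsRat 2 S).idealOne) :=
  IwasawaH1Data.existsUnique_lift_of_isEulerSystem_two W hκ I S z hz
    (fun n x ↦ levelToLayerTwo_layerCores_comm W hκ S n x) hint

/-! ## §3 The zeta class at `p = 2` from a `ZetaBody` witness -/

/-- **The Λ-adic zeta class is PINNED at `p = 2` (Kato §13.1 / Thm. 13.4, "`Z` … generated by `(z_{p^n})_n`").**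
Let `(κ', Λ', z, x)` satisfy `ZetaBody W 2 f ι κ' Λ' c d a A z x` (Kato's Euler system for `T₂W` with its values;
named facts `exists_eulerSystem_expStar_values` under `Irr(W[2])`, resp. `exists_member_eulerSystem_expStar_values`
at Kato's member — no parity hypothesis for existence and norm relations). Then for any cyclotomic `ℤ₂`-tower
datum `I : IwasawaH1Data W 2 κ γ` there is a UNIQUE `𝐲 ∈ 𝐇¹_Γ(T₂W)` whose `n`-th layer component is
`Cor_{ℚ(μ_{2^{n+2}})/ℚ_n}(z_{n+2,∅})` for every `n`: the Euler-system relations (C1) give the norm compatibility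
(`levelToLayerTwo_layerCores_comm`), the unramifiedness (C2) and `coresLe_mem_integralH1` (with `ℚ(μ_{2^{n+2}})/ℚ`
normal and unramified away from `2`) give the integrality, and the pin `IwasawaH1Data.exists_unique_lift` gives
`𝐲`. The `p = 2` twin of `IwasawaH1Data.existsUnique_lift_of_zetaBody`. No hypothesis beyond the `ZetaBody`
witness; nothing asserted. [cite: Kato2004Asterisque, §13.1 and Thm. 13.4 (pp. 224–226), §12.2 (p. 220), §8.2 (pp. 180–181)]
[cite: Washington1997, §13.1] -/
theorem IwasawaH1Data.existsUnique_lift_of_zetaBody_two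
    [Module.Free ℤ_[2] (W.tateModule 2)] [Module.Finite ℤ_[2] (W.tateModule 2)]
    {N : ℕ} (f : CuspForm (CongruenceSubgroup.Gamma0 N) 2)
    (ι : (m : ℕ) → (CyclotomicField m ℚ →+* ℂ)) (κ' : ℝ)
    (Λ' : ∀ (k : ℕ) (r : Finset (HeightOneSpectrum (𝓞 ℚ))),
      H1 (tateRep W 2) (cycSubgroup 2 k r) →ₗ[ℤ_[2]] ℚ_[2] ⊗[ℚ] CyclotomicField (cycLevel 2 k r) ℚ)
    (c d a : ℤ) (A : ℕ)
    (z : ∀ (k : ℕ) (r : (cyclotomicLevelsRat 2 (badPlaces c d A N)).Ideals),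
      H1 (tateRep W 2) ((cyclotomicLevelsRat 2 (badPlaces c d A N)).level k r.1))
    (x : ∀ (k : ℕ) (r : (cyclotomicLevelsRat 2 (badPlaces c d A N)).Ideals),
      CyclotomicField (cycLevel 2 k r.1) ℚ)
    (hbody : ZetaBody W 2 f ι κ' Λ' c d a A z x) :
    ∃! y : I.H, ∀ n : ℕ,
      I.proj n y = levelToLayerTwo W hκ (badPlaces c d A N) n
        (z (n + 2) (cyclotomicLevelsRat 2 (badPlaces c d A N)).idealOne) := by
  refine IwasawaH1Data.existsUnique_lift_of_isEulerSystem_of_integral_two W hκ I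
    (badPlaces c d A N) z hbody.1 fun n ↦ ?_
  -- integrality of the corestricted class: (C2) + `coresLe_mem_integralH1`
  haveI : ((cyclotomicLevelsRat 2 (badPlaces c d A N)).level (n + 2) ∅).Normal :=
    normal_cyclotomicLevelsRat_level_empty 2 (badPlaces c d A N) (n + 2)
  haveI : ((cyclotomicLevelsRat 2 (badPlaces c d A N)).level (n + 2) ∅).FiniteIndex :=
    finiteIndex_of_isOpen_of_compactSpace _
      ((cyclotomicLevelsRat 2 (badPlaces c d A N)).isOpen_level (n + 2) ∅)
  haveI : Fintype (κ.layerSubgroup n ⧸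
      ((cyclotomicLevelsRat 2 (badPlaces c d A N)).level (n + 2) ∅).subgroupOf (κ.layerSubgroup n)) :=
    Fintype.ofFinite _
  have hz : z (n + 2) (cyclotomicLevelsRat 2 (badPlaces c d A N)).idealOne ∈
      integralH1 (tateRep W 2) 2 ((cyclotomicLevelsRat 2 (badPlaces c d A N)).level (n + 2) ∅) :=
    fun v hv 𝔓 h𝔓 ↦ hbody.2.1 (n + 2) (cyclotomicLevelsRat 2 (badPlaces c d A N)).idealOne v hv 𝔓 h𝔓
  have key := coresLe_mem_integralH1 (tateRep W 2) 2
    (hκ.cyclotomicLevelsRat_level_le_layerSubgroup_two (badPlaces c d A N) n)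
    ((cyclotomicLevelsRat 2 (badPlaces c d A N)).isOpen_level (n + 2) ∅)
    (fun v hv ↦ cyclotomicLevelsRat_level_empty_unramifiedAt 2 (badPlaces c d A N) (n + 2) v hv) hz
  unfold levelToLayerTwo
  convert key using 4

end Literature.NumberTheory.EllipticCurves.Kato2004

end
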